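import Mathlib
import Summits.Ventures.PercRepro2.SepSplitLive

/-!
# Gluing at a general separator, XIV: the doubly symmetrised kernel — the pointwise criterion for a
vanishing orbit sum (blind cell PercRepro2, mine-2 g49, 2026-08-29; `conjectures/MINE-2.md` M2-103)

The `S₃`-orbit sum of the glued root counts of a far data triple `p` is the typed count of the
symmetrised kernel on the three glued states (`orbitRootS_eq_typedCount_KBsym`); the typed count
is invariant under the six permutations of the copies, and `KBsym` under the six permutations of
its arguments, so the orbit sum is also the typed count of each of the six ASSIGNMENTS of the far
data to the copies.  Summing them: **`six_mul_orbitRootS_eq_typedCount_dsym`**: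
`6 · orbitRootS p = typedCount B z τ (dsymK side p ∘ (root data of the three copies))`, where the
DOUBLY SYMMETRISED KERNEL `dsymK side p hx hy hw` is the sum over the six assignments of
`KBsym (gluedS hx p_σ1 side) (gluedS hy p_σ2 side) (gluedS hw p_σ3 side)` — a function of the three
ROOT DATA only.  Hence (`orbitRootS_eq_zero_of_dsymZero`): if `dsymK side p` vanishes on every
triple of REAL root data (`DsymZero`, a finite check for a finite separator), the orbit sum is
zero on every root side, realised or not.  The rule and the equality locus read on the
triples that are not (`typedCount_nonneg_of_sepSplit_realised_dsym`,
`typedCount_eq_zero_iff_of_sepSplit_dsym`); every dead triple of `SepSplitLive` is of this kind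
(its six mechanisms are pointwise on the glued states — not re-derived here).
The census of M2-103 (kit j333492, `dsymorb.c`) is the twin: on the sampled root sides the orbits
never nonzero are exactly the `DsymZero` ones.  Own work; standard axioms.
-/

namespace Summit.Ventures.PercRepro2

open UnionCluster

namespace CovForm

namespace RootBridge

open OneTyped TypedA3 Untouched TypedFactor Separated

/-! ## The symmetrised kernel is symmetric -/

section Sym

/-- `KBsym` under the swap of its first two arguments. -/
lemma KBsym_comm12 (a b c : St) : KBsym b a c = KBsym a b c := by
  unfold KBsym; ring

/-- `KBsym` under the swap of its last two arguments. -/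
lemma KBsym_comm23 (a b c : St) : KBsym a c b = KBsym a b c := by
  unfold KBsym; ring

/-- `KBsym` under the swap of its first and third arguments. -/
lemma KBsym_comm13 (a b c : St) : KBsym c b a = KBsym a b c := by
  unfold KBsym; ring

/-- `KBsym` under the cyclic shift `(a, b, c) ↦ (b, c, a)`. -/
lemma KBsym_cyc (a b c : St) : KBsym b c a = KBsym a b c := by
  unfold KBsym; ring

/-- `KBsym` under the cyclic shift `(a, b, c) ↦ (c, a, b)`. -/
lemma KBsym_cyc' (a b c : St) : KBsym c a b = KBsym a b c := by
  unfold KBsym; ring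

end Sym

/-! ## The doubly symmetrised kernel -/

section Dsym

variable {ι : Type*}

/-- **The doubly symmetrised kernel** of the far data triple `p` on the root data `hx, hy, hw` of
the three copies: the symmetrised kernel on the glued states, summed over the six assignments of
the far data to the copies. -/
noncomputable def dsymK (side : Fin 5 → Bool) (p : Pat3S ι) (hx hy hw : SideData ι) : ℤ :=
  KBsym (gluedS hx p.1 side) (gluedS hy p.2.1 side) (gluedS hw p.2.2 side) +
    KBsym (gluedS hx p.2.1 side) (gluedS hy p.1 side) (gluedS hw p.2.2 side) +
    KBsym (gluedS hx p.1 side) (gluedS hy p.2.2 side) (gluedS hw p.2.1 side) +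
    KBsym (gluedS hx p.2.2 side) (gluedS hy p.2.1 side) (gluedS hw p.1 side) +
    KBsym (gluedS hx p.2.1 side) (gluedS hy p.2.2 side) (gluedS hw p.1 side) +
    KBsym (gluedS hx p.2.2 side) (gluedS hy p.1 side) (gluedS hw p.2.1 side)

/-- The far triple is DOUBLY-SYMMETRISED ZERO: its doubly symmetrised kernel vanishes on every
triple of real root data. -/
def DsymZero (side : Fin 5 → Bool) (p : Pat3S ι) : Prop :=
  ∀ hx hy hw : SideData ι, SDreal hx → SDreal hy → SDreal hw → dsymK side p hx hy hw = 0

end Dsym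

/-! ## Six times the orbit sum is the typed count of the doubly symmetrised kernel -/

section Main

open Classical

variable {V : Type*} {E : Type*} {ι : Type*} [Fintype E] [DecidableEq E] {R : Type*} [Field R]
variable (ends : E → Sym2 V) (mk : Fin 5 → V) (σ : ι → V)

/-- The root datum of a root-side configuration. -/
noncomputable def rootDatum (VH : Set V) (x : Config E) : SideData ι :=
  sideData ends mk σ (withinRestr ends VH x)

/-- **Six times the orbit sum is the typed count of the doubly symmetrised kernel** on the root
data of the three copies (types in `{1, 2}` on `B`). -/
theorem six_mul_orbitRootS_eq_typedCount_dsym (side : Fin 5 → Bool) (VH : Set V) (B : Finset E)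
    (z : Config E) (τ : E → ℕ) (hτ : ∀ e ∈ B, τ e = 1 ∨ τ e = 2) (p : Pat3S ι) :
    6 * orbitRootS ends mk σ side VH B z τ p =
      typedCount B z τ (fun x y w => ((dsymK side p (rootDatum ends mk σ VH x)
        (rootDatum ends mk σ VH y) (rootDatum ends mk σ VH w) : ℤ) : R)) := by
  rw [orbitRootS_eq_typedCount_KBsym ends mk σ side VH B z τ hτ p]
  -- the six assignments, each carried back to the diagonal
  have t2 : typedCount B z τ (fun x y w => ((KBsym (gst ends mk σ side VH p.2.1 x)
      (gst ends mk σ side VH p.1 y) (gst ends mk σ side VH p.2.2 w) : ℤ) : R)) =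
      typedCount B z τ (fun x y w => ((KBsym (gst ends mk σ side VH p.1 x)
        (gst ends mk σ side VH p.2.1 y) (gst ends mk σ side VH p.2.2 w) : ℤ) : R)) := by
    rw [← typedCount_swap12 B z τ (fun x y w => ((KBsym (gst ends mk σ side VH p.1 x)
      (gst ends mk σ side VH p.2.1 y) (gst ends mk σ side VH p.2.2 w) : ℤ) : R))]
    exact typedCount_congr' _ _ _ _ _ fun x y w => by rw [KBsym_comm12]
  have t3 : typedCount B z τ (fun x y w => ((KBsym (gst ends mk σ side VH p.1 x)
      (gst ends mk σ side VH p.2.2 y) (gst ends mk σ side VH p.2.1 w) : ℤ) : R)) =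
      typedCount B z τ (fun x y w => ((KBsym (gst ends mk σ side VH p.1 x)
        (gst ends mk σ side VH p.2.1 y) (gst ends mk σ side VH p.2.2 w) : ℤ) : R)) := by
    rw [← typedCount_swap23 B z τ hτ (fun x y w => ((KBsym (gst ends mk σ side VH p.1 x)
      (gst ends mk σ side VH p.2.1 y) (gst ends mk σ side VH p.2.2 w) : ℤ) : R))]
    exact typedCount_congr' _ _ _ _ _ fun x y w => by rw [KBsym_comm23]
  have t4 : typedCount B z τ (fun x y w => ((KBsym (gst ends mk σ side VH p.2.2 x)
      (gst ends mk σ side VH p.2.1 y) (gst ends mk σ side VH p.1 w) : ℤ) : R)) =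
      typedCount B z τ (fun x y w => ((KBsym (gst ends mk σ side VH p.1 x)
        (gst ends mk σ side VH p.2.1 y) (gst ends mk σ side VH p.2.2 w) : ℤ) : R)) := by
    rw [← typedCount_swap13 B z τ hτ (fun x y w => ((KBsym (gst ends mk σ side VH p.1 x)
      (gst ends mk σ side VH p.2.1 y) (gst ends mk σ side VH p.2.2 w) : ℤ) : R))]
    exact typedCount_congr' _ _ _ _ _ fun x y w => by rw [KBsym_comm13]
  have t5 : typedCount B z τ (fun x y w => ((KBsym (gst ends mk σ side VH p.2.1 x)
      (gst ends mk σ side VH p.2.2 y) (gst ends mk σ side VH p.1 w) : ℤ) : R)) =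
      typedCount B z τ (fun x y w => ((KBsym (gst ends mk σ side VH p.1 x)
        (gst ends mk σ side VH p.2.1 y) (gst ends mk σ side VH p.2.2 w) : ℤ) : R)) := by
    have s1 := typedCount_swap12 B z τ (fun x y w => ((KBsym (gst ends mk σ side VH p.1 w)
      (gst ends mk σ side VH p.2.1 y) (gst ends mk σ side VH p.2.2 x) : ℤ) : R))
    have s2 := typedCount_swap13 B z τ hτ (fun x y w => ((KBsym (gst ends mk σ side VH p.1 x)
      (gst ends mk σ side VH p.2.1 y) (gst ends mk σ side VH p.2.2 w) : ℤ) : R))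
    rw [← s2, ← s1]
    exact typedCount_congr' _ _ _ _ _ fun x y w => by rw [KBsym_cyc]
  have t6 : typedCount B z τ (fun x y w => ((KBsym (gst ends mk σ side VH p.2.2 x)
      (gst ends mk σ side VH p.1 y) (gst ends mk σ side VH p.2.1 w) : ℤ) : R)) =
      typedCount B z τ (fun x y w => ((KBsym (gst ends mk σ side VH p.1 x)
        (gst ends mk σ side VH p.2.1 y) (gst ends mk σ side VH p.2.2 w) : ℤ) : R)) := by
    have s1 := typedCount_swap12 B z τ (fun x y w => ((KBsym (gst ends mk σ side VH p.1 x)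
      (gst ends mk σ side VH p.2.1 w) (gst ends mk σ side VH p.2.2 y) : ℤ) : R))
    have s2 := typedCount_swap23 B z τ hτ (fun x y w => ((KBsym (gst ends mk σ side VH p.1 x)
      (gst ends mk σ side VH p.2.1 y) (gst ends mk σ side VH p.2.2 w) : ℤ) : R))
    rw [← s2, ← s1]
    exact typedCount_congr' _ _ _ _ _ fun x y w => by rw [KBsym_cyc']
  have hsum : typedCount B z τ (fun x y w => ((dsymK side p (rootDatum ends mk σ VH x)
      (rootDatum ends mk σ VH y) (rootDatum ends mk σ VH w) : ℤ) : R)) =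
      typedCount B z τ (fun x y w => ((KBsym (gst ends mk σ side VH p.1 x)
        (gst ends mk σ side VH p.2.1 y) (gst ends mk σ side VH p.2.2 w) : ℤ) : R)) +
      typedCount B z τ (fun x y w => ((KBsym (gst ends mk σ side VH p.2.1 x)
        (gst ends mk σ side VH p.1 y) (gst ends mk σ side VH p.2.2 w) : ℤ) : R)) +
      typedCount B z τ (fun x y w => ((KBsym (gst ends mk σ side VH p.1 x)
        (gst ends mk σ side VH p.2.2 y) (gst ends mk σ side VH p.2.1 w) : ℤ) : R)) +
      typedCount B z τ (fun x y w => ((KBsym (gst ends mk σ side VH p.2.2 x)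
        (gst ends mk σ side VH p.2.1 y) (gst ends mk σ side VH p.1 w) : ℤ) : R)) +
      typedCount B z τ (fun x y w => ((KBsym (gst ends mk σ side VH p.2.1 x)
        (gst ends mk σ side VH p.2.2 y) (gst ends mk σ side VH p.1 w) : ℤ) : R)) +
      typedCount B z τ (fun x y w => ((KBsym (gst ends mk σ side VH p.2.2 x)
        (gst ends mk σ side VH p.1 y) (gst ends mk σ side VH p.2.1 w) : ℤ) : R)) := by
    rw [← typedCount_add', ← typedCount_add', ← typedCount_add', ← typedCount_add',
      ← typedCount_add']
    refine typedCount_congr' _ _ _ _ _ fun x y w => ?_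
    unfold dsymK gst rootDatum
    push_cast
    ring
  rw [hsum, t2, t3, t4, t5, t6]
  ring

end Main

/-! ## Vanishing, the dead triples, the rule and the locus -/

section Vanish

open Classical

variable {V : Type*} {E : Type*} {ι : Type*} [Fintype E] [DecidableEq E] {R : Type*} [Field R]
  [LinearOrder R] [IsStrictOrderedRing R]
variable (ends : E → Sym2 V) (mk : Fin 5 → V) (σ : ι → V)

/-- **A doubly-symmetrised-zero triple has orbit sum zero** on every root side (types in
`{1, 2}`), realised or not. -/
theorem orbitRootS_eq_zero_of_dsymZero (side : Fin 5 → Bool) (VH : Set V) (B : Finset E)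
    (z : Config E) (τ : E → ℕ) (hτ : ∀ e ∈ B, τ e = 1 ∨ τ e = 2) (p : Pat3S ι)
    (hp : DsymZero side p) : orbitRootS ends mk σ side VH B z τ p = (0 : R) := by
  have h6 := six_mul_orbitRootS_eq_typedCount_dsym ends mk σ side VH B z τ hτ p (R := R)
  have hz : typedCount B z τ (fun x y w => ((dsymK side p (rootDatum ends mk σ VH x)
      (rootDatum ends mk σ VH y) (rootDatum ends mk σ VH w) : ℤ) : R)) = 0 := by
    rw [← typedCount_zero_kernel B z τ]
    refine typedCount_congr' _ _ _ _ _ fun x y w => ?_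
    unfold rootDatum
    rw [hp _ _ _ (sideData_real ends mk σ _) (sideData_real ends mk σ _)
      (sideData_real ends mk σ _)]
    simp
  rw [hz] at h6
  exact (mul_eq_zero.mp h6).resolve_left (by norm_num)

/-- **Row 2′TRI at any split, from the realised orbits that are not doubly-symmetrised zero.** -/
theorem typedCount_nonneg_of_sepSplit_realised_dsym [Fintype ι] [DecidableEq ι]
    {side : Fin 5 → Bool} {VL VH : Set V} (F : Finset E) (z : Config E) (τ : E → ℕ)
    (hτ : ∀ e ∈ F, τ e = 1 ∨ τ e = 2) (h : SepSplit ends mk σ side VL VH F z)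
    (hroot : ∀ p : Pat3S ι,
      typedCount (sideF ends VL F) z τ
          (farKS ends mk σ VL p : Config E → Config E → Config E → R) ≠ 0 →
      ¬ DsymZero side p → (0 : R) ≤ orbitRootS ends mk σ side VH (sideF ends VH F) z τ p) :
    0 ≤ typedCount F z τ
      (K3 ends (mk 0) (mk 1) (mk 2) (mk 3) (mk 4) : Config E → Config E → Config E → R) := by
  refine typedCount_nonneg_of_sepSplit_realised ends mk σ F z τ hτ h fun p hp => ?_
  by_cases hd : DsymZero side p
  · exact (orbitRootS_eq_zero_of_dsymZero ends mk σ side VH (sideF ends VH F) z τ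
      (fun e he => hτ e (Finset.filter_subset _ _ he)) p hd).ge
  · exact hroot p hp hd

/-- **The equality locus at any split, on the orbits that are not doubly-symmetrised zero**
(under the sign hypothesis on them). -/
theorem typedCount_eq_zero_iff_of_sepSplit_dsym [Fintype ι] [DecidableEq ι]
    {side : Fin 5 → Bool} {VL VH : Set V} (F : Finset E) (z : Config E) (τ : E → ℕ)
    (hτ : ∀ e ∈ F, τ e = 1 ∨ τ e = 2) (h : SepSplit ends mk σ side VL VH F z)
    (hroot : ∀ p : Pat3S ι,
      typedCount (sideF ends VL F) z τ
          (farKS ends mk σ VL p : Config E → Config E → Config E → R) ≠ 0 →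
      ¬ DsymZero side p → (0 : R) ≤ orbitRootS ends mk σ side VH (sideF ends VH F) z τ p) :
    typedCount F z τ
        (K3 ends (mk 0) (mk 1) (mk 2) (mk 3) (mk 4) : Config E → Config E → Config E → R) = 0 ↔
      ∀ p : Pat3S ι,
        typedCount (sideF ends VL F) z τ
            (farKS ends mk σ VL p : Config E → Config E → Config E → R) ≠ 0 →
          ¬ DsymZero side p →
            orbitRootS ends mk σ side VH (sideF ends VH F) z τ p = (0 : R) := by
  have hτB : ∀ e ∈ sideF ends VH F, τ e = 1 ∨ τ e = 2 :=
    fun e he => hτ e (Finset.filter_subset _ _ he)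
  have hroot' : ∀ p : Pat3S ι,
      typedCount (sideF ends VL F) z τ
          (farKS ends mk σ VL p : Config E → Config E → Config E → R) ≠ 0 →
      (0 : R) ≤ orbitRootS ends mk σ side VH (sideF ends VH F) z τ p := fun p hp => by
    by_cases hd : DsymZero side p
    · exact (orbitRootS_eq_zero_of_dsymZero ends mk σ side VH (sideF ends VH F) z τ hτB p hd).ge
    · exact hroot p hp hd
  rw [typedCount_eq_zero_iff_of_sepSplit ends mk σ F z τ hτ h hroot']
  constructor
  · intro hz p hp _
    exact hz p hp
  · intro hz p hp
    by_cases hd : DsymZero side p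
    · exact orbitRootS_eq_zero_of_dsymZero ends mk σ side VH (sideF ends VH F) z τ hτB p hd
    · exact hz p hp hd

end Vanish

end RootBridge

end CovForm

end Summit.Ventures.PercRepro2
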